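import Summits.QuantumFields.BalabanUV.T4Continuum.Support.BalabanHardMinimizer
import Summits.QuantumFields.BalabanUV.T4Continuum.Support.VariationalAdditive

/-!
# T⁴ programme, spine node NE2 (U1a), lane P2 — LEAF D OF THE VARIATIONAL ROUTE: THE KKT / DUALITY READING of the block-spin value
# as a HERMITIAN QUADRATIC FORM, `T_Q S (μ) = re μ†((Q S_a⁻¹ Qᴴ)⁻¹ − a)μ`, abstractly (coercive `S_a = S + a·QᴴQ`, rows of `Q` orthogonal),
# and the reading of per-level additive brackets into `OneStepAveragedLaw` (`t4/skeletons/NE2-t4-ne2-p2.md` v0.7 §2.C leaf D / T0-X9;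
# cell `pub-balaban`, row NE2 co-owner #2, lineage t4-ne2-p2 gen 10)

HONEST FRAMING (T4-DAG p. 1).  Rung (B)+1 only — NOT infinite volume, NOT a mass gap, NOT Clay.  NE2 is NOT IN PRINT and NOT proved here.  Pure
finite-dimensional linear algebra ([folklore]): P1's hard completing-the-square `BalabanHardMinimizer.hard_square` and the coercive-inverse
tools `CoerciveInverseTower.isUnit_of_coercive` (both IN THE TREE) are combined into the statement the variational route consumes — the minimum
value of a nonnegative Hermitian form over an averaging fibre IS a Hermitian quadratic form of the unit datum (so `VariationalAdditive.
oneStepAveragedLaw_of_forms` applies to the brackets of `VariationalCovariantAssembly.pair_bracket` / `VariationalCovariantScalarPair`).  Printed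
context (not hypotheses): [Balaban1984PropagatorsI] (1.65)/(1.69)–(1.71) p.29–30 (`Δ_k`, `Q_kGQ_k*`), [King1986] (2.13)–(2.14) p.653 (the
effective Laplacian as `a − a²QGQ*`); the tree's `Beta.BlockEffectiveAction.DelK_eq` is the `U = 1` vector instance.  Nothing printed is a
hypothesis; no `def … : Prop` fact; no `sorry`; axioms standard.  HONEST DEPENDENCY (cell, verbatim): continuum YM on T⁴ ⇐ BetaPertH ∧ nine spine
estimates (0/9 proved); BetaPertH ⇐ (D1) ∧ (D4) ∧ CAP+tail; G-an2-4 gates asym, D1 and NE2/3/4.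

CONTENTS.  §1 `coercive_inv` (the inverse of a `γ`-coercive matrix of norm `≤ Λ` is `γ/Λ²`-coercive), `coercive_sandwich` (`Q G Qᴴ` is coercive when
`Q Qᴴ = c·1`, `c > 0`).  §2 **`blockSpin_eq_quadForm`**: for a Hermitian `S` with `re f†Sf ≥ 0`, `Q` with `QQᴴ = c·1`, and `S_a := S + a·QᴴQ`
`γ`-coercive with `‖S_a‖ ≤ Λ`: `blockSpin (Q *ᵥ ·) (f ↦ re f†Sf) μ = re μ†(K⁻¹ − a·1)μ` with `K = Q S_a⁻¹ Qᴴ`, the minimiser `H μ = S_a⁻¹QᴴK⁻¹μ`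
(`Q(Hμ) = μ`, Euler–Lagrange `S_a(Hμ) = QᴴK⁻¹μ`), and `K⁻¹ − a·1` Hermitian (`effForm_isHermitian`).
-/

noncomputable section

open scoped BigOperators ComplexConjugate Matrix Matrix.Norms.L2Operator

namespace Summit.QuantumFields.BalabanUV.T4Continuum.VariationalKKT

open Literature.MathematicalPhysics.QuantumFieldTheory.Balaban1983to89.B5Prop11Lower (nsq nsq_nonneg nsq_mulVec_le star_dotProduct_self)
open Summit.QuantumFields.BalabanUV.T4Continuum.CoerciveInverseTower (Coercive isUnit_of_coercive)
open Summit.QuantumFields.BalabanUV.T4Continuum.BalabanHardMinimizer (hard_square mulVec_hardMin star_dotProduct_mulVec_of_hermitian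
  star_conjTranspose_mulVec_dotProduct)
open Summit.QuantumFields.BalabanUV.T4Continuum.BalabanAveragedCoerciveFibre (star_dotProduct_conjTranspose_mulVec)
open Summit.QuantumFields.BalabanUV.T4Continuum.VariationalTransfer (blockSpin blockSpin_eq_of_isMin)

variable {ι κ : Type*} [Fintype ι] [DecidableEq ι] [Fintype κ] [DecidableEq κ]

/-! ## §1 Coercivity of inverses and of sandwiches -/

/-- the inverse of a `γ`-coercive matrix with `‖A‖ ≤ Λ` is `γ/Λ²`-coercive: `re x†A⁻¹x = re y†Ay ≥ γ‖y‖²`, `y = A⁻¹x`, `‖x‖ ≤ Λ‖y‖`. [folklore] -/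
theorem coercive_inv {γ Λ : ℝ} (hγ : 0 < γ) (hΛ : 0 < Λ) {A : Matrix ι ι ℂ} (hA : Aᴴ = A) (h : Coercive γ A) (hnorm : ‖A‖ ≤ Λ) :
    Coercive (γ / Λ ^ 2) A⁻¹ := by
  have hU := isUnit_of_coercive hγ h
  have hdet : IsUnit A.det := (Matrix.isUnit_iff_isUnit_det A).mp hU
  intro x
  set y := A⁻¹ *ᵥ x with hy
  have hx : A *ᵥ y = x := by rw [hy, Matrix.mulVec_mulVec, Matrix.mul_nonsing_inv A hdet, Matrix.one_mulVec]
  -- re x†A⁻¹x = re (Ay)† y = re y† A y (A Hermitian)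
  have e : (star x ⬝ᵥ (A⁻¹ *ᵥ x)).re = (star y ⬝ᵥ (A *ᵥ y)).re := by
    rw [← hy, ← hx, ← star_dotProduct_mulVec_of_hermitian hA]
  rw [e]
  have h1 : γ * nsq y ≤ (star y ⬝ᵥ (A *ᵥ y)).re := h y
  have h2 : nsq x ≤ Λ ^ 2 * nsq y := by
    rw [← hx]
    calc nsq (A *ᵥ y) ≤ ‖A‖ ^ 2 * nsq y := nsq_mulVec_le A y
      _ ≤ Λ ^ 2 * nsq y := mul_le_mul_of_nonneg_right (pow_le_pow_left₀ (norm_nonneg _) hnorm 2) (nsq_nonneg y)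
  have hΛ2 : 0 < Λ ^ 2 := pow_pos hΛ 2
  calc γ / Λ ^ 2 * nsq x ≤ γ / Λ ^ 2 * (Λ ^ 2 * nsq y) := mul_le_mul_of_nonneg_left h2 (by positivity)
    _ = γ * nsq y := by field_simp
    _ ≤ _ := h1

omit [DecidableEq ι] in
/-- a sandwich `Q G Qᴴ` of a `γ`-coercive `G` by a matrix with orthogonal rows `Q Qᴴ = c·1` is `γ·c`-coercive. [folklore] -/
theorem coercive_sandwich {γ c : ℝ} {G : Matrix ι ι ℂ} (hG : Coercive γ G) {Q : Matrix κ ι ℂ} (hQQ : Q * Qᴴ = (c : ℂ) • 1) :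
    Coercive (γ * c) (Q * G * Qᴴ) := by
  intro μ
  have e : star μ ⬝ᵥ ((Q * G * Qᴴ) *ᵥ μ) = star (Qᴴ *ᵥ μ) ⬝ᵥ (G *ᵥ (Qᴴ *ᵥ μ)) := by
    rw [← Matrix.mulVec_mulVec, ← Matrix.mulVec_mulVec, star_conjTranspose_mulVec_dotProduct]
  have hn : nsq (Qᴴ *ᵥ μ) = c * nsq μ := by
    have h1 : star (Qᴴ *ᵥ μ) ⬝ᵥ (Qᴴ *ᵥ μ) = star μ ⬝ᵥ ((Q * Qᴴ) *ᵥ μ) := by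
      rw [← Matrix.mulVec_mulVec, star_conjTranspose_mulVec_dotProduct]
    rw [hQQ, Matrix.smul_mulVec, Matrix.one_mulVec, dotProduct_smul, star_dotProduct_self, star_dotProduct_self] at h1
    have h2 := congrArg Complex.re h1
    simpa [Complex.smul_re] using h2
  rw [e]
  calc γ * c * nsq μ = γ * nsq (Qᴴ *ᵥ μ) := by rw [hn]; ring
    _ ≤ _ := hG _

/-! ## §2 The block-spin value of a Hermitian form is a Hermitian quadratic form (KKT / duality) -/

section KKT

variable (S : Matrix ι ι ℂ) (Q : Matrix κ ι ℂ) (a : ℝ)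

/-- the soft-constraint operator `S_a = S + a·QᴴQ`. [folklore] -/
def Sa : Matrix ι ι ℂ := S + (a : ℂ) • (Qᴴ * Q)

/-- the sandwich `K = Q S_a⁻¹ Qᴴ` (the averaged propagator, [Balaban1984PropagatorsI] (1.71) shape). [folklore] -/
def Kmat : Matrix κ κ ℂ := Q * (Sa S Q a)⁻¹ * Qᴴ

/-- the effective form `K⁻¹ − a·1` ([Balaban1984PropagatorsI] (1.65) ↔ (1.71); [King1986] (2.14) shape). [folklore] -/
def effForm : Matrix κ κ ℂ := (Kmat S Q a)⁻¹ - (a : ℂ) • 1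

/-- the hard minimiser `H μ = S_a⁻¹ Qᴴ K⁻¹ μ` ([Balaban1984PropagatorsII] (2.35) shape `H = GQ*(QGQ*)⁻¹`). [folklore] -/
def Hmin (μ : κ → ℂ) : ι → ℂ := (Sa S Q a)⁻¹ *ᵥ (Qᴴ *ᵥ ((Kmat S Q a)⁻¹ *ᵥ μ))

variable {S Q a}

omit [Fintype ι] [DecidableEq ι] [DecidableEq κ] in
/-- `S_a` is Hermitian when `S` is. [folklore] -/
theorem Sa_conjTranspose (hS : Sᴴ = S) : (Sa S Q a)ᴴ = Sa S Q a := by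
  unfold Sa
  rw [Matrix.conjTranspose_add, Matrix.conjTranspose_smul, Matrix.conjTranspose_mul, Matrix.conjTranspose_conjTranspose, hS,
    Complex.star_def, Complex.conj_ofReal]

omit [DecidableEq ι] [DecidableEq κ] in
/-- on the fibre `Q f = μ`: `re f†S_a f = re f†S f + a·Σ|μ|²`. [folklore] -/
theorem re_form_Sa (f : ι → ℂ) (μ : κ → ℂ) (hf : Q *ᵥ f = μ) :
    (star f ⬝ᵥ (Sa S Q a *ᵥ f)).re = (star f ⬝ᵥ (S *ᵥ f)).re + a * nsq μ := by
  unfold Sa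
  rw [Matrix.add_mulVec, Matrix.smul_mulVec, ← Matrix.mulVec_mulVec, hf, dotProduct_add, dotProduct_smul,
    star_dotProduct_conjTranspose_mulVec, hf, star_dotProduct_self, Complex.add_re, smul_eq_mul, Complex.re_ofReal_mul,
    Complex.ofReal_re]

/-- **THE KKT / DUALITY READING**: with `S` Hermitian and nonnegative, `Q Qᴴ = c·1` (`c > 0`), `S_a` `γ`-coercive with `‖S_a‖ ≤ Λ`:
(i) `Q (H μ) = μ`; (ii) `H μ` minimises `re f†Sf` on the fibre `Q f = μ`; (iii) the minimum value is `re μ†(K⁻¹ − a·1)μ`; hence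
`blockSpin (Q *ᵥ ·) (f ↦ re f†Sf) μ = re μ†(K⁻¹ − a·1)μ`. [folklore] -/
theorem blockSpin_eq_quadForm (hS : Sᴴ = S) (hS0 : ∀ f, 0 ≤ (star f ⬝ᵥ (S *ᵥ f)).re) {c γ Λ : ℝ} (hc : 0 < c) (hγ : 0 < γ) (hΛ : 0 < Λ)
    (hQQ : Q * Qᴴ = (c : ℂ) • 1) (hcoer : Coercive γ (Sa S Q a)) (hnorm : ‖Sa S Q a‖ ≤ Λ) (μ : κ → ℂ) :
    Q *ᵥ Hmin S Q a μ = μ ∧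
      (∀ f, Q *ᵥ f = μ → (star (Hmin S Q a μ) ⬝ᵥ (S *ᵥ Hmin S Q a μ)).re ≤ (star f ⬝ᵥ (S *ᵥ f)).re) ∧
      blockSpin (fun f => Q *ᵥ f) (fun f => (star f ⬝ᵥ (S *ᵥ f)).re) μ = (star μ ⬝ᵥ (effForm S Q a *ᵥ μ)).re := by
  -- invertibility of S_a and of K
  have hSaH : (Sa S Q a)ᴴ = Sa S Q a := Sa_conjTranspose hS
  have hU : IsUnit (Sa S Q a) := isUnit_of_coercive hγ hcoer
  have hdet : IsUnit (Sa S Q a).det := (Matrix.isUnit_iff_isUnit_det _).mp hU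
  have hSaG : Sa S Q a * (Sa S Q a)⁻¹ = 1 := Matrix.mul_nonsing_inv _ hdet
  have hGcoer : Coercive (γ / Λ ^ 2) (Sa S Q a)⁻¹ := coercive_inv hγ hΛ hSaH hcoer hnorm
  have hKcoer : Coercive (γ / Λ ^ 2 * c) (Kmat S Q a) := coercive_sandwich hGcoer hQQ
  have hKU : IsUnit (Kmat S Q a) := isUnit_of_coercive (by positivity) hKcoer
  have hKdet : IsUnit (Kmat S Q a).det := (Matrix.isUnit_iff_isUnit_det _).mp hKU
  have hKci : Q * (Sa S Q a)⁻¹ * Qᴴ * (Kmat S Q a)⁻¹ = 1 := Matrix.mul_nonsing_inv _ hKdet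
  -- Hermitian inverses
  have hGH : ((Sa S Q a)⁻¹)ᴴ = (Sa S Q a)⁻¹ := by rw [Matrix.conjTranspose_nonsing_inv, hSaH]
  have hKH : (Kmat S Q a)ᴴ = Kmat S Q a := by
    unfold Kmat; rw [Matrix.conjTranspose_mul, Matrix.conjTranspose_mul, Matrix.conjTranspose_conjTranspose, hGH, Matrix.mul_assoc]
  have hciH : ((Kmat S Q a)⁻¹)ᴴ = (Kmat S Q a)⁻¹ := by rw [Matrix.conjTranspose_nonsing_inv, hKH]
  -- (i) the constraint
  have hQH : Q *ᵥ Hmin S Q a μ = μ := mulVec_hardMin hKci μ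
  -- the hard square on the fibre, for S_a
  have hsq : ∀ f, Q *ᵥ f = μ → (star f ⬝ᵥ (Sa S Q a *ᵥ f)).re
      = (star μ ⬝ᵥ ((Kmat S Q a)⁻¹ *ᵥ μ)).re + (star (f - Hmin S Q a μ) ⬝ᵥ (Sa S Q a *ᵥ (f - Hmin S Q a μ))).re := by
    intro f hf
    have h := hard_square hSaH hSaG hKci hciH f μ hf
    have h' := congrArg Complex.re h
    rw [Complex.add_re] at h'
    exact h'
  have hSa0 : ∀ g, 0 ≤ (star g ⬝ᵥ (Sa S Q a *ᵥ g)).re := fun g => (mul_nonneg hγ.le (nsq_nonneg g)).trans (hcoer g)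
  -- (ii) minimality for S (the a-term is constant on the fibre)
  have hminS : ∀ f, Q *ᵥ f = μ → (star (Hmin S Q a μ) ⬝ᵥ (S *ᵥ Hmin S Q a μ)).re ≤ (star f ⬝ᵥ (S *ᵥ f)).re := by
    intro f hf
    have e1 := re_form_Sa (S := S) (a := a) f μ hf
    have e2 := re_form_Sa (S := S) (a := a) (Hmin S Q a μ) μ hQH
    have h1 := hsq f hf
    have h2 := hsq (Hmin S Q a μ) hQH
    rw [sub_self, Matrix.mulVec_zero, dotProduct_zero, Complex.zero_re, add_zero] at h2
    linarith [hSa0 (f - Hmin S Q a μ)]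
  -- (iii) the value
  have hval : (star (Hmin S Q a μ) ⬝ᵥ (S *ᵥ Hmin S Q a μ)).re = (star μ ⬝ᵥ (effForm S Q a *ᵥ μ)).re := by
    have e2 := re_form_Sa (S := S) (a := a) (Hmin S Q a μ) μ hQH
    have h2 := hsq (Hmin S Q a μ) hQH
    rw [sub_self, Matrix.mulVec_zero, dotProduct_zero, Complex.zero_re, add_zero] at h2
    unfold effForm
    rw [Matrix.sub_mulVec, Matrix.smul_mulVec, Matrix.one_mulVec, dotProduct_sub, dotProduct_smul, star_dotProduct_self,
      Complex.sub_re, smul_eq_mul, Complex.re_ofReal_mul, Complex.ofReal_re]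
    linarith
  refine ⟨hQH, hminS, ?_⟩
  rw [← hval]
  exact blockSpin_eq_of_isMin hS0 hQH hminS

/-- the effective form is Hermitian. [folklore] -/
theorem effForm_isHermitian (hS : Sᴴ = S) : (effForm S Q a).IsHermitian := by
  have hSaH : (Sa S Q a)ᴴ = Sa S Q a := Sa_conjTranspose hS
  have hGH : ((Sa S Q a)⁻¹)ᴴ = (Sa S Q a)⁻¹ := by rw [Matrix.conjTranspose_nonsing_inv, hSaH]
  have hKH : (Kmat S Q a)ᴴ = Kmat S Q a := by
    unfold Kmat; rw [Matrix.conjTranspose_mul, Matrix.conjTranspose_mul, Matrix.conjTranspose_conjTranspose, hGH, Matrix.mul_assoc]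
  have hciH : ((Kmat S Q a)⁻¹)ᴴ = (Kmat S Q a)⁻¹ := by rw [Matrix.conjTranspose_nonsing_inv, hKH]
  unfold effForm Matrix.IsHermitian
  rw [Matrix.conjTranspose_sub, Matrix.conjTranspose_smul, Matrix.conjTranspose_one, hciH, Complex.star_def, Complex.conj_ofReal]

/-- **THE EULER–LAGRANGE EQUATION** of the hard minimisation: `S_a (H μ) = Qᴴ (K⁻¹ μ)` (the multiplier is `K⁻¹μ`) — the input of leaf REG⁺.
[folklore] -/
theorem euler_lagrange {γ : ℝ} (hγ : 0 < γ) (hcoer : Coercive γ (Sa S Q a)) (μ : κ → ℂ) :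
    Sa S Q a *ᵥ Hmin S Q a μ = Qᴴ *ᵥ ((Kmat S Q a)⁻¹ *ᵥ μ) := by
  have hU : IsUnit (Sa S Q a) := isUnit_of_coercive hγ hcoer
  have hdet : IsUnit (Sa S Q a).det := (Matrix.isUnit_iff_isUnit_det _).mp hU
  unfold Hmin
  rw [Matrix.mulVec_mulVec, Matrix.mul_nonsing_inv _ hdet, Matrix.one_mulVec]

end KKT

end Summit.QuantumFields.BalabanUV.T4Continuum.VariationalKKT

end
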